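import Summits.QuantumFields.YangMills.Theorems.UnitScaleTiltProp7N32SymLocalisedRow
import Summits.QuantumFields.YangMills.Theorems.UnitScaleTiltProp7N32SymExchangeReals
import Summits.QuantumFields.YangMills.Theorems.UnitScaleTiltProp7LevelRatioSubReducedT3
import Summits.QuantumFields.YangMills.Theorems.UnitScaleTiltProp7LocalisedMassCentreChainsT3
import Summits.QuantumFields.YangMills.Theorems.UnitScaleTiltProp7L1LevelExpT3
import Summits.QuantumFields.YangMills.Theorems.UnitScaleTiltProp7PertVarNormGradLevelZeroT3
import Summits.QuantumFields.YangMills.Theorems.UnitScaleTiltProp7N32SymLinearLetterT3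
import Summits.QuantumFields.YangMills.Theorems.UnitScaleTiltProp7SymFrameRem2RowOfN32SymT3
import HarnessLib

/-!
# Route `UnitScaleTilt`, crux K1 «MinimiserStabilityRegPr» (stmt-QuantumFields-19200), route-R (β) R0 REM2ˢ, row «(n3)₂-sym» = H2-1ˢ —
# THE «(n3)₂-sym» SUPPLIER AT THE T³ MEMBER: px16's displayed OPEN row `hN2s` of ✓`Prop7SymFrameRem2RowOfN32Sym.hRs_of_hN2s` AS A TREE THEOREM

Cell `ym3-torus` (HUMAN RULING D-0037: YM₃ on the three-torus is ladder rung R3 — not d = 4, not infinite volume, not a mass gap, not Clay), width seat `ym3-torus-px21` (gen 7),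
pen of the «(n3)₂-sym» supplier line (px13 g6 «GO» 2026-08-29 07:50Z; bricks by w5 g8 (N2′, N3), w3-20520 g11 (N4, N4∕S), px13 g6 (N4b), w5-20520 g10 (N5),
routeR-w3 g8 (N6d), this seat (N1, N6a, N6b, N6s, N6c-R, N6c-X)).  THEOREMS ONLY (0 `def`, 0 `sorry`); `--supports stmt-QuantumFields-19200 --as helper`, count-neutral.
Nothing here claims (β), `hD`, the stub `stub_existenceMinimalOrbit`, the crux, d = 4 or the mass gap: `hN2s` is ONE of the three rows of px16's S32ᴸ display.
THE ARGUMENT (LOCATE evidence #52).  Second-order family `D′_l := Y_l − Q_l(iX)` of the plain symmetric tower at `W ∈ 𝔘_k(e)`, `W′ = e^{iX}W`; ✓N6a∕N6b: the true-linearised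
recursion's defect in `ℓ¹` through the SPARSE coarse-gauge channel on the centre chains ∕ support families OF RECORD, local `ℓ¹`∕`ℓ²` propagation, localised first-order masses taken
to level 0 (✓N3) where ✓N4∕N4∕S localise them by volume fraction with ✓N4b's Weitzenböck gap; global first-order masses by (n3), deviations by ✓N6d; level sums geometric (✓N5,
✓N6c-R); currencies by ★routeR-w4's exchange (✓N6c-X); the `fderiv` letter is `Q_l(iX)` (✓N6s).
§1 ★★★ `sum_norm_levelRatio_sub_trueLinIter_le_of_regPr` — the level row at the member, mixed currency, EVERY row discharged by a tree theorem ((n3) ✓`sum_normSq_levelRatio_le_LOnly_T3`,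
✓N6d, ✓N4∕S twice, ✓`chartSups`∕`supNumerals`∕`loop_size_geom`∕`size_numerals`, ✓`l1_level_exp_le_T3`∕`level_exp_le`, families by ✓`exists_*_family`).
§2 ★★★ `hN2s_holds` — px16's `hN2s` token for token (`e₂ = T⁻¹`, `T = 10¹⁴L⁹ + 4·10¹¹L⁹(2B₁′)`; `A₂ B₂ B₂′` the polynomials of ✓N6c-X), and the kernel witness `hRs_of_hN2s hN2s_holds`.
References: T. Bałaban, CMP 98 (1985) 17–51 [Balaban1985Averaging] (Prop. 3 (122)–(126) p.36, Prop. 4 (134)–(135) p.38); CMP 95 (1984) 17–40 [Balaban1984PropagatorsI]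
((1.18)–(1.20)); CMP 102 (1985) 277–309 [Balaban1985Variational] ((2), (15), (19)–(20), (44)–(48), Prop. 7); CMP 109 (1987) 249–301 [Balaban1987RG1] ((0.3)–(0.4)).
-/

set_option autoImplicit false

noncomputable section

open scoped BigOperators Matrix.Norms.L2Operator Matrix Topology

namespace Summit.QuantumFields.YangMills.Theorems.Prop7N32SymRow

open Literature.MathematicalPhysics.QuantumFieldTheory.Balaban1983to89
open Literature.MathematicalPhysics.QuantumFieldTheory.Balaban1983to89.T3ContinuumYM3Torus
open Literature.MathematicalPhysics.QuantumFieldTheory.Balaban1983to89.T3PrintedRegularMinimiser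
open Literature.MathematicalPhysics.QuantumFieldTheory.Balaban1983to89.T3RegularMinimiser
open B10Eq27TorusAxialLog (unitsField toUField)
open B9Eq39Adjoint (curl divB)
open B9TorusCalculus (torusT)
open T3SectALandauChart (In19 bgUnits emb15 eta)
open NormedSpace (exp)
open Summit.QuantumFields.YangMills.Theorems.Prop7TPrint (expHermField)
open Summit.QuantumFields.YangMills.Theorems.Prop7N32SymLocalisedRow (sum_norm_levelRatio_sub_trueLinIter_le_of_rows)
open Summit.QuantumFields.YangMills.Theorems.Prop7N32SymLevelRowReals (exp_two_mul_le_of gapX_shape loc1_shape final_shape)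
open Summit.QuantumFields.YangMills.Theorems.Prop7CurvedLandauKnitT3 (smallness_T3 three_le_L)
open Summit.QuantumFields.YangMills.Theorems.Prop7CurvedLandauRowE (loop_size_geom size_numerals)
open Summit.QuantumFields.YangMills.Theorems.Prop7CovIterLambdaBound (plaqSmall_of_le_of_lt)
open Summit.QuantumFields.YangMills.Theorems.Prop7TwistedLevelMassOfRegPr (plaq_le_of_regPr window_weak)
open Summit.QuantumFields.YangMills.Theorems.Prop7JointRowTowerData (chartSups supNumerals)
open Summit.QuantumFields.YangMills.Theorems.Prop7L1LevelExpT3 (l1_level_exp_le_T3)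
open Summit.QuantumFields.YangMills.Theorems.Prop7FibreLevelMassT3Letters (level_exp_le)
open Summit.QuantumFields.YangMills.Theorems.Prop7PertVarNormGradLevelZeroT3 (sum_sq_norm_sub_norm_pertVar_le_of_regPr_T3 sum_sq_norm_sub_norm_I_smul_le_plaqK)
open Summit.QuantumFields.YangMills.Theorems.Prop7PertVarCurrencyExchange (curlHS_pertVar_le_plaqK divHS_pertVar_le norm_pertVar_sub_lin_le sum_normSq_pertVar_le)
open Summit.QuantumFields.YangMills.Theorems.Prop7FrameRem2RowZeroT3 (coe_emb15_expHermField_apply)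
open Summit.QuantumFields.YangMills.Theorems.Prop7CurvedLandauRowA (exists_coarseGauge_family exists_reduced_family exists_trueLinIter_family)
open Summit.QuantumFields.YangMills.Theorems.Prop7LineIterVsEngineOfTower (exists_pureLine_family)
open Summit.QuantumFields.YangMills.Theorems.Prop7LevelRatioSubReducedT3 (sum_normSq_levelRatio_sub_reduced_le_T3)
open Summit.QuantumFields.YangMills.Theorems.Prop7LocalisedMassCentreChainsT3 (sum_centres_sum_normSq_bond_le)
open Literature.MathematicalPhysics.QuantumFieldTheory.Balaban1983to89.T3UnitLawDensityEML (ℰp)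
open Literature.MathematicalPhysics.QuantumFieldTheory.Balaban1983to89.T3ConstrainedMinimiser (fibre)
open Literature.MathematicalPhysics.QuantumFieldTheory.Balaban1983to89.T3Thm1Carrier
open Finset T4Continuum T4ReflectionCone BlockAveraging AveragingRT ExpMeanLog BlockAveragingEMLLinearised BlockAveragingEMLLinearisedBackground BlockAveragingEMLProp2
open B7Prop1Explicit (expUnit val_expUnit)
open Summit.QuantumFields.YangMills.Theorems.Prop8Chart (emlIterU)
open Summit.QuantumFields.YangMills.Theorems.Prop7SPrint (AvgCondPrint IsLandauPrint)
open Summit.QuantumFields.YangMills.Theorems.Prop7N32SymLinearLetterT3 (fderiv_emlIterU_mul_star_eq_trueLinIter_of_regPr)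
open Summit.QuantumFields.YangMills.Theorems.Prop7N32SymExchangeReals (cd_shape exchange_shape constants_nonneg)
open Summit.QuantumFields.YangMills.Theorems.Prop7SymFrameRem2RowOfN32Sym (hRs_of_hN2s)

/-! ## §1 ★★★ The level row at the T³ member -/

set_option maxHeartbeats 400000 in
-- HEARTBEAT rule (README): the instantiation of ✓`Prop7N32SymLocalisedRow.sum_norm_levelRatio_sub_trueLinIter_le_of_rows` at `P := F.P K` with the (n3)∕N6d∕N4∕S rows and the four
-- scalar shapes measures ≈ 150–200k (the hb-100k scratch fails at that application by `isDefEq` on the tower letters; default 200k passes with no margin on a loaded farm node) —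
-- no `decide`, no search, pure elaboration of long letters.
/-- ★★★ **THE SECOND-ORDER REMAINDER OF THE LEVEL RATIOS IN `ℓ¹` AT THE T³ MEMBER, TWO-SLOT FORM, MIXED CURRENCY** — every row discharged by a tree theorem.
[cite: Balaban1985Averaging, Prop. 3 (122)-(126) p.36, Prop. 4 (134)-(135) p.38; Balaban1984PropagatorsI, (1.18)-(1.20) pp.19-20; Balaban1985Variational, (15) p.280, (47)-(48) pp.285-286, Prop. 7 p.299] -/
theorem sum_norm_levelRatio_sub_trueLinIter_le_of_regPr (F : T3Family) (n K : ℕ) {e s : ℝ} (he : 0 < e) (heL : 100000000000000 * (F.L : ℝ) ^ 9 * e ≤ 1)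
    (hs0 : 0 ≤ s) (hs4 : 4 * s ≤ 1) (hsL : 400000000000 * (F.L : ℝ) ^ 9 * (((F.L : ℝ) ^ (K - n)) * s) ≤ 1)
    {W : GaugeField (F.P K) 0 (Matrix.specialUnitaryGroup (Fin 2) ℂ)} (hreg : RegPr F n K e W)
    (X : PBond (F.P K) 0 → Matrix (Fin 2) (Fin 2) ℂ) (hX : ∀ b : PBond (F.P K) 0, (X b).IsHermitian ∧ Matrix.trace (X b) = 0)
    (hsX : ∀ b : PBond (F.P K) 0, ‖X b‖ ≤ s)
    (Q : (k : ℕ) → (PBond (F.P K) 0 → Matrix (Fin 2) (Fin 2) ℂ) → PBond (F.P K) k → Matrix (Fin 2) (Fin 2) ℂ) (hQ0 : ∀ Y, Q 0 Y = Y)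
    (hQs : ∀ (k : ℕ) (Y : PBond (F.P K) 0 → Matrix (Fin 2) (Fin 2) ℂ) (c : PBond (F.P K) (k + 1)), Q (k + 1) Y c
      = (fderiv ℂ (eml : (Idx (F.P K) → Matrix (Fin 2) (Fin 2) ℂ) → Matrix (Fin 2) (Fin 2) ℂ)
            (fun i => ((loopHol (Averaging.iter (fun i => blockAvg (P := (F.P K)) (j := i) (expMeanLogSU (n := Fin 2))) k W) c i : Matrix.specialUnitaryGroup (Fin 2) ℂ) : Matrix (Fin 2) (Fin 2) ℂ))
            (fun i => covWalkSum (Averaging.iter (fun i => blockAvg (P := (F.P K)) (j := i) (expMeanLogSU (n := Fin 2))) k W) (Q k Y) (walk (emb c.src) (loopWord (F.P K).L c.dir (off i.1) i.2.1 i.2.2))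
              * ((loopHol (Averaging.iter (fun i => blockAvg (P := (F.P K)) (j := i) (expMeanLogSU (n := Fin 2))) k W) c i : Matrix.specialUnitaryGroup (Fin 2) ℂ) : Matrix (Fin 2) (Fin 2) ℂ))
            * star ((corr (expMeanLogSU (n := Fin 2)) (Averaging.iter (fun i => blockAvg (P := (F.P K)) (j := i) (expMeanLogSU (n := Fin 2))) k W) c : Matrix.specialUnitaryGroup (Fin 2) ℂ) : Matrix (Fin 2) (Fin 2) ℂ) + ((corr (expMeanLogSU (n := Fin 2)) (Averaging.iter (fun i => blockAvg (P := (F.P K)) (j := i) (expMeanLogSU (n := Fin 2))) k W) c : Matrix.specialUnitaryGroup (Fin 2) ℂ) : Matrix (Fin 2) (Fin 2) ℂ)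
            * covWalkSum (Averaging.iter (fun i => blockAvg (P := (F.P K)) (j := i) (expMeanLogSU (n := Fin 2))) k W) (Q k Y) (walk (emb c.src) (List.replicate (F.P K).L (c.dir, true)))
            * star ((corr (expMeanLogSU (n := Fin 2)) (Averaging.iter (fun i => blockAvg (P := (F.P K)) (j := i) (expMeanLogSU (n := Fin 2))) k W) c : Matrix.specialUnitaryGroup (Fin 2) ℂ) : Matrix (Fin 2) (Fin 2) ℂ))) :
    ∀ l < K - n, ∑ c : PBond (F.P K) l, ‖(pertVar (Averaging.iter (fun i => blockAvg (P := (F.P K)) (j := i) (expMeanLogSU (n := Fin 2))) l W) (Averaging.iter (fun i => blockAvg (P := (F.P K)) (j := i) (expMeanLogSU (n := Fin 2))) l (emb15 W (expHermField X)))) c - Q l (fun b => Complex.I • X b) c‖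
      ≤ (3 / 2 * ((∑ b : PBond (F.P K) 0, ‖X b‖ ^ 2) / 2) + 3 / 2 * (234000 * (F.L : ℝ) ^ 5 * (7 * (∑ b : PBond (F.P K) 0, ‖pertVar W (emb15 W (expHermField X)) b‖ ^ 2))) * (((F.L : ℝ) - 1)⁻¹ * (F.L : ℝ) ^ 2) + 6 * (5 * (F.L : ℝ) * (3 / 2)) * (2 * ((∑ b : PBond (F.P K) 0, ‖X b‖ ^ 2) / 2) * ((F.L : ℝ) ^ 6 / ((F.L : ℝ) - 1))) + 6 * (5 * (F.L : ℝ) * (3 / 2)) * (234000 * (F.L : ℝ) ^ 5 * (9 / 2) * (2 * (∑ b : PBond (F.P K) 0, ‖pertVar W (emb15 W (expHermField X)) b‖ ^ 2)) * ((F.L : ℝ) ^ 8 / (((F.L : ℝ) ^ 2 - 1) * ((F.L : ℝ) - 1))))) * ((F.L : ℝ) ^ l)⁻¹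
          + (3 / 2 * (234000 * (F.L : ℝ) ^ 5 * (28800 * (F.L : ℝ) ^ 4 * ((∑ x : Site (F.P K) 0, ∑ μ : Fin (F.P K).d, ∑ ν : Fin (F.P K).d, (if μ < ν then ∑ j : Fin 2, ∑ k : Fin 2, ‖(curl (torusT (F.P K) 0) (fun κ z => unitsField (toUField W) ⟨z, κ⟩) (fun κ z => pertVar W (emb15 W (expHermField X)) ⟨z, κ⟩) μ ν x) j k‖ ^ 2 else 0)) + (∑ x : Site (F.P K) 0, ∑ j : Fin 2, ∑ k : Fin 2, ‖(divB (torusT (F.P K) 0) (fun κ z => unitsField (toUField W) ⟨z, κ⟩) (fun κ z => pertVar W (emb15 W (expHermField X)) ⟨z, κ⟩) x) j k‖ ^ 2))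
          + 600000 * (F.L : ℝ) ^ 4 * (((F.L : ℝ) ^ (K - n)) ^ 2)⁻¹ * (∑ b : PBond (F.P K) 0, ‖pertVar W (emb15 W (expHermField X)) b‖ ^ 2))) * (1 - (F.L : ℝ)⁻¹ ^ 3)⁻¹ + 6 * (5 * (F.L : ℝ) * (3 / 2)) * (26136 * ((4 * (∑ p : Plaq (F.P K) 0, ‖((Complex.I • X ⟨p.src, p.μ⟩) + ((W ⟨p.src, p.μ⟩ : Matrix (Fin 2) (Fin 2) ℂ) * (Complex.I • X ⟨p.src.shift p.μ, p.ν⟩) * star (W ⟨p.src, p.μ⟩ : Matrix (Fin 2) (Fin 2) ℂ)) - (((W ⟨p.src, p.μ⟩ * W ⟨p.src.shift p.μ, p.ν⟩ * (W ⟨p.src.shift p.ν, p.μ⟩)⁻¹ : Matrix.specialUnitaryGroup (Fin 2) ℂ) : Matrix (Fin 2) (Fin 2) ℂ) * (Complex.I • X ⟨p.src.shift p.ν, p.μ⟩) * star ((W ⟨p.src, p.μ⟩ * W ⟨p.src.shift p.μ, p.ν⟩ * (W ⟨p.src.shift p.ν, p.μ⟩)⁻¹ : Matrix.specialUnitaryGroup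 (Fin 2) ℂ) : Matrix (Fin 2) (Fin 2) ℂ)) - (((GaugeField.plaqHol W p : Matrix.specialUnitaryGroup (Fin 2) ℂ) : Matrix (Fin 2) (Fin 2) ℂ) * (Complex.I • X ⟨p.src, p.ν⟩) * star ((GaugeField.plaqHol W p : Matrix.specialUnitaryGroup (Fin 2) ℂ) : Matrix (Fin 2) (Fin 2) ℂ)))‖ ^ 2)
          + (∑ x : Site (F.P K) 0, ∑ j : Fin 2, ∑ k : Fin 2, ‖(divB (torusT (F.P K) 0) (fun κ z => unitsField (toUField W) ⟨z, κ⟩) (fun κ z => Complex.I • X ⟨z, κ⟩) x) j k‖ ^ 2) + (192 * (e * (((F.L : ℝ) ^ (K - n)) ^ 2)⁻¹) ^ 2 + 12 * (e * (((F.L : ℝ) ^ (K - n)) ^ 2)⁻¹)) * (∑ b : PBond (F.P K) 0, ‖X b‖ ^ 2)) / 2) * (F.L : ℝ) ^ 2) + 6 * (5 * (F.L : ℝ) * (3 / 2)) * (234000 * (F.L : ℝ) ^ 5 * (9 / 2) * (26136 * (8 * (∑ p : Plaq (F.P K) 0, ‖((Complex.I • X ⟨p.src, p.μ⟩)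
          + ((W ⟨p.src, p.μ⟩ : Matrix (Fin 2) (Fin 2) ℂ) * (Complex.I • X ⟨p.src.shift p.μ, p.ν⟩) * star (W ⟨p.src, p.μ⟩ : Matrix (Fin 2) (Fin 2) ℂ)) - (((W ⟨p.src, p.μ⟩ * W ⟨p.src.shift p.μ, p.ν⟩ * (W ⟨p.src.shift p.ν, p.μ⟩)⁻¹ : Matrix.specialUnitaryGroup (Fin 2) ℂ) : Matrix (Fin 2) (Fin 2) ℂ) * (Complex.I • X ⟨p.src.shift p.ν, p.μ⟩) * star ((W ⟨p.src, p.μ⟩ * W ⟨p.src.shift p.μ, p.ν⟩ * (W ⟨p.src.shift p.ν, p.μ⟩)⁻¹ : Matrix.specialUnitaryGroup (Fin 2) ℂ) : Matrix (Fin 2) (Fin 2) ℂ)) - (((GaugeField.plaqHol W p : Matrix.specialUnitaryGroup (Fin 2) ℂ) : Matrix (Fin 2) (Fin 2) ℂ) * (Complex.I • X ⟨p.src, p.ν⟩) * star ((GaugeField.plaqHol W p : Matrix.specialUnitaryGroup (Fin 2) ℂ) : Matrix (Fin 2) (Fin 2) ℂ)))‖ ^ 2)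
          + 2 * (∑ x : Site (F.P K) 0, ∑ j : Fin 2, ∑ k : Fin 2, ‖(divB (torusT (F.P K) 0) (fun κ z => unitsField (toUField W) ⟨z, κ⟩) (fun κ z => Complex.I • X ⟨z, κ⟩) x) j k‖ ^ 2) + (384 * (e * (((F.L : ℝ) ^ (K - n)) ^ 2)⁻¹) ^ 2 + 60 * s ^ 2 + 12 * (e * (((F.L : ℝ) ^ (K - n)) ^ 2)⁻¹)) * (∑ b : PBond (F.P K) 0, ‖X b‖ ^ 2))) * ((F.L : ℝ) ^ 4 * (((F.L : ℝ) - 1) ^ 2)⁻¹)) + 6 * (5 * (F.L : ℝ) * (3 / 2)) * (234000 * (F.L : ℝ) ^ 5 * (2 * 8) * (72 * (200 * (F.L : ℝ) ^ 4 * ((∑ x : Site (F.P K) 0, ∑ μ : Fin (F.P K).d, ∑ ν : Fin (F.P K).d, (if μ < ν then ∑ j : Fin 2, ∑ k : Fin 2, ‖(curl (torusT (F.P K) 0) (fun κ z => unitsField (toUField W) ⟨z, κ⟩) (fun κ z => pertVar W (emb15 W (expHermField X)) ⟨z, κ⟩) μ ν x) j k‖ ^ 2 else 0))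
          + (∑ x : Site (F.P K) 0, ∑ j : Fin 2, ∑ k : Fin 2, ‖(divB (torusT (F.P K) 0) (fun κ z => unitsField (toUField W) ⟨z, κ⟩) (fun κ z => pertVar W (emb15 W (expHermField X)) ⟨z, κ⟩) x) j k‖ ^ 2)) + 4 * 10 ^ 9 * (F.L : ℝ) ^ 9 * e * (((F.L : ℝ) ^ (K - n)) ^ 2)⁻¹ * (∑ b : PBond (F.P K) 0, ‖pertVar W (emb15 W (expHermField X)) b‖ ^ 2)) + 2000000 * (F.L : ℝ) ^ 4 * (3744000 * (F.L : ℝ) ^ 7 * (((F.L : ℝ) ^ (K - n)) * s)) ^ 2 * (((F.L : ℝ) ^ (K - n)) ^ 2)⁻¹ * (∑ b : PBond (F.P K) 0, ‖pertVar W (emb15 W (expHermField X)) b‖ ^ 2)) * ((1 - (F.L : ℝ)⁻¹ ^ 3)⁻¹ * ((F.L : ℝ) - 1)⁻¹))) * (F.L : ℝ) ^ l := by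
  intro l hl
  -- T³ letters
  have hL3 : (3 : ℝ) ≤ (F.L : ℝ) := three_le_L F
  have hL0 : (0 : ℝ) < (F.L : ℝ) := by linarith
  have hLF : (F.P K).L = F.L := rfl
  have hd : (F.P K).d = 3 := T3Family.P_d F K
  have hk : l ≤ (F.P K).m + (F.P K).K := by show l ≤ F.m + K; omega
  have hKn : K - n ≤ (F.P K).m + (F.P K).K := by show K - n ≤ F.m + K; omega
  have hℓ1 : (1 : ℝ) ≤ (F.L : ℝ) ^ (K - n) := one_le_pow₀ (by linarith)
  -- windows and guards
  have heL' := window_weak F he heL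
  have hUe := plaq_le_of_regPr F n K hreg
  obtain ⟨hsup, hμ⟩ := chartSups F n K he heL hs0 hs4 hsL hreg X hX hsX
  obtain ⟨-, hμ0, hμ72, hμN, hμθ, hθ0, hθL⟩ := supNumerals F n K hs0 hsL
  -- (n3): the first-order level masses
  have hn3 := Prop7FibreLevelMassPerLevelT3.sum_normSq_levelRatio_le_LOnly_T3 F n K W (emb15 W (expHermField X)) he heL' hUe
    (fun j : ℕ => 480 * (F.L : ℝ) ^ 4 * (F.L : ℝ) ^ j * s) hμ0 hμ hμ72 hμN hθ0 hμθ hθL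
  -- the recursion families of `Y_0 = pertVar W W′` and N6d (routeR-w3 g8 ✓p711360): the deviation row
  obtain ⟨G1, hG10, hG1s⟩ := exists_reduced_family (P := F.P K) (N := 2) W (pertVar W (emb15 W (expHermField X)))
  obtain ⟨S, hS0, hSs⟩ := exists_pureLine_family (P := F.P K) W (pertVar W (emb15 W (expHermField X)))
  obtain ⟨Λ, hΛ0, hΛs⟩ := exists_coarseGauge_family (P := F.P K) (N := 2) W G1
  have hdev := sum_normSq_levelRatio_sub_reduced_le_T3 F n K W (emb15 W (expHermField X)) he heL' hUe Q hQ0 hQs G1 S Λ hG10 hS0 hΛ0 hΛs hG1s hSs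
    (fun j : ℕ => 480 * (F.L : ℝ) ^ 4 * (F.L : ℝ) ^ j * s) hμ0 hμ hμ72 hμN hθ0 hμθ hθL
  -- the loop sizes of the background tower (geometric form)
  obtain ⟨-, hε3, hε2, hε24, -⟩ := smallness_T3 F K he heL'
  have hε' : 0 < 2 * e := by linarith only [he]
  have hU' : PlaqSmall (2 * e * (((((F.P K).L : ℝ)) ^ (K - n))⁻¹) ^ 2) W := by
    refine plaqSmall_of_le_of_lt hUe ?_
    rw [hLF, inv_pow]
    exact mul_lt_mul_of_pos_right (by linarith only [he]) (inv_pos.mpr (by positivity))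
  have hαg := loop_size_geom (N := 2) (K - n) hε' hε3 hε2 hU'
  obtain ⟨hale, h24, hN⟩ := size_numerals (N := 2) (K - n) hε' hε2 hε24
  -- scalar identities (d = 3)
  have eμ : ∀ j : ℕ, ((((F.P K).d + 2) * (F.P K).L : ℕ) : ℝ) * ((2 * (F.P K).d * ((F.P K).L : ℝ) ^ (F.P K).d) * (16 * (F.L : ℝ) ^ j * s))
      = 480 * (F.L : ℝ) ^ 4 * (F.L : ℝ) ^ j * s := by
    intro j; rw [hd]; push_cast; simp only [hLF]; ring
  have ecE : (260 * (((((F.P K).d + 2) * (F.P K).L : ℕ) : ℝ)) ^ 2 * (2 * (F.P K).d * ((F.P K).L : ℝ) ^ (F.P K).d) * (2 * (F.P K).d)) = 234000 * (F.L : ℝ) ^ 5 := by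
    rw [hd]; push_cast; simp only [hLF]; ring
  have eCL : ((((F.P K).d + 2) * (F.P K).L : ℕ) : ℝ) = 5 * (F.L : ℝ) := by rw [hd]; norm_num [hLF]
  have eCd : (2 : ℝ) * ((F.P K).d : ℝ) = 6 := by rw [hd]; norm_num
  have etd : (2 : ℝ) ^ (F.P K).d = 8 := by rw [hd]; norm_num
  have eL : (((F.P K).L : ℕ) : ℝ) = (F.L : ℝ) := by rw [hLF]
  have hd' : ((F.P K).d : ℝ) = 3 := by rw [hd]; norm_num
  have hρ₁ : ((((F.P K).L : ℝ) ^ (F.P K).d)⁻¹ * ((F.P K).L : ℝ)) ≤ (((F.P K).L : ℝ) ^ 2)⁻¹ := by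
    rw [hd]; simp only [hLF]
    rw [show (((F.L : ℝ)) ^ 3)⁻¹ * (F.L : ℝ) = ((F.L : ℝ) ^ 2)⁻¹ by field_simp]
  have hρ₂ : ((((F.P K).L : ℝ) ^ (F.P K).d)⁻¹ * ((F.P K).L : ℝ) ^ 2) ≤ (((F.P K).L : ℝ))⁻¹ := by
    rw [hd]; simp only [hLF]
    rw [show (((F.L : ℝ)) ^ 3)⁻¹ * (F.L : ℝ) ^ 2 = ((F.L : ℝ))⁻¹ by field_simp]
  have hL2 : (2 : ℝ) ≤ ((F.P K).L : ℝ) := by simp only [hLF]; linarith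
  -- the chart: `W′ = e^{iX}·W` bondwise
  have hUX := coe_emb15_expHermField_apply F W X hX
  have hpt : ∀ b : PBond (F.P K) 0, ‖pertVar W (emb15 W (expHermField X)) b - Complex.I • X b‖ ≤ ‖X b‖ ^ 2 / 2 := fun b =>
    norm_pertVar_sub_lin_le W (emb15 W (expHermField X)) X (fun b' => (hX b').1) hUX b
  have hD0 : ∑ b : PBond (F.P K) 0, ‖pertVar W (emb15 W (expHermField X)) b - Complex.I • X b‖ ≤ (∑ b : PBond (F.P K) 0, ‖X b‖ ^ 2) / 2 := by
    rw [Finset.sum_div]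
    exact Finset.sum_le_sum fun b _ => hpt b
  -- the norm gaps at level 0: N4b (pertVar) and its `iX` twin
  have hN4b := sum_sq_norm_sub_norm_pertVar_le_of_regPr_T3 F n K he.le hreg X hX hsX
  have ha0' : 0 ≤ (e * (((F.L : ℝ) ^ (K - n)) ^ 2)⁻¹) := by positivity
  have hI := sum_sq_norm_sub_norm_I_smul_le_plaqK (N := 2) W ha0' hUe X
  have hIeq : ∑ b : PBond (F.P K) 0, ∑ ν : Fin (F.P K).d, (‖Complex.I • X ⟨b.src.shift ν, b.dir⟩‖ - ‖Complex.I • X b‖) ^ 2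
      = ∑ b : PBond (F.P K) 0, ∑ ν : Fin (F.P K).d, (‖X ⟨b.src.shift ν, b.dir⟩‖ - ‖X b‖) ^ 2 := by
    simp only [norm_smul, Complex.norm_I, one_mul]
  have hgapX : ∑ b : PBond (F.P K) 0, ∑ ν : Fin (F.P K).d, (‖X ⟨b.src.shift ν, b.dir⟩‖ - ‖X b‖) ^ 2
      ≤ 4 * (∑ p : Plaq (F.P K) 0, ‖((Complex.I • X ⟨p.src, p.μ⟩) + ((W ⟨p.src, p.μ⟩ : Matrix (Fin 2) (Fin 2) ℂ) * (Complex.I • X ⟨p.src.shift p.μ, p.ν⟩) * star (W ⟨p.src, p.μ⟩ : Matrix (Fin 2) (Fin 2) ℂ)) - (((W ⟨p.src, p.μ⟩ * W ⟨p.src.shift p.μ, p.ν⟩ * (W ⟨p.src.shift p.ν, p.μ⟩)⁻¹ : Matrix.specialUnitaryGroup (Fin 2) ℂ) : Matrix (Fin 2) (Fin 2) ℂ) * (Complex.I • X ⟨p.src.shift p.ν, p.μ⟩) * star ((W ⟨p.src, p.μ⟩ * W ⟨p.src.shift p.μ, p.ν⟩ * (W ⟨p.src.shift p.ν, p.μ⟩)⁻¹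 : Matrix.specialUnitaryGroup (Fin 2) ℂ) : Matrix (Fin 2) (Fin 2) ℂ)) - (((GaugeField.plaqHol W p : Matrix.specialUnitaryGroup (Fin 2) ℂ) : Matrix (Fin 2) (Fin 2) ℂ) * (Complex.I • X ⟨p.src, p.ν⟩) * star ((GaugeField.plaqHol W p : Matrix.specialUnitaryGroup (Fin 2) ℂ) : Matrix (Fin 2) (Fin 2) ℂ)))‖ ^ 2)
          + (∑ x : Site (F.P K) 0, ∑ j : Fin 2, ∑ k : Fin 2, ‖(divB (torusT (F.P K) 0) (fun κ z => unitsField (toUField W) ⟨z, κ⟩) (fun κ z => Complex.I • X ⟨z, κ⟩) x) j k‖ ^ 2) + (192 * (e * (((F.L : ℝ) ^ (K - n)) ^ 2)⁻¹) ^ 2 + 12 * (e * (((F.L : ℝ) ^ (K - n)) ^ 2)⁻¹)) * (∑ b : PBond (F.P K) 0, ‖X b‖ ^ 2) :=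
    gapX_shape (by norm_num) hd' ((le_of_eq hIeq.symm).trans hI)
  -- nonnegativity of the member's sums (explicit terms: no `positivity` on sums over the torus types)
  have hMX0 : 0 ≤ (∑ b : PBond (F.P K) 0, ‖X b‖ ^ 2) := Finset.sum_nonneg fun _ _ => sq_nonneg _
  have hM00 : 0 ≤ (∑ b : PBond (F.P K) 0, ‖pertVar W (emb15 W (expHermField X)) b‖ ^ 2) := Finset.sum_nonneg fun _ _ => sq_nonneg _
  have hKX0 : 0 ≤ (∑ p : Plaq (F.P K) 0, ‖((Complex.I • X ⟨p.src, p.μ⟩) + ((W ⟨p.src, p.μ⟩ : Matrix (Fin 2) (Fin 2) ℂ) * (Complex.I • X ⟨p.src.shift p.μ, p.ν⟩) * star (W ⟨p.src, p.μ⟩ : Matrix (Fin 2) (Fin 2) ℂ)) - (((W ⟨p.src, p.μ⟩ * W ⟨p.src.shift p.μ, p.ν⟩ * (W ⟨p.src.shift p.ν, p.μ⟩)⁻¹ : Matrix.specialUnitaryGroup (Fin 2) ℂ) : Matrix (Fin 2) (Fin 2) ℂ) * (Complex.I • X ⟨p.src.shift p.ν, p.μ⟩) * star ((W ⟨p.src,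 p.μ⟩ * W ⟨p.src.shift p.μ, p.ν⟩ * (W ⟨p.src.shift p.ν, p.μ⟩)⁻¹ : Matrix.specialUnitaryGroup (Fin 2) ℂ) : Matrix (Fin 2) (Fin 2) ℂ)) - (((GaugeField.plaqHol W p : Matrix.specialUnitaryGroup (Fin 2) ℂ) : Matrix (Fin 2) (Fin 2) ℂ) * (Complex.I • X ⟨p.src, p.ν⟩) * star ((GaugeField.plaqHol W p : Matrix.specialUnitaryGroup (Fin 2) ℂ) : Matrix (Fin 2) (Fin 2) ℂ)))‖ ^ 2) := Finset.sum_nonneg fun _ _ => sq_nonneg _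
  have hDX0 : 0 ≤ (∑ x : Site (F.P K) 0, ∑ j : Fin 2, ∑ k : Fin 2, ‖(divB (torusT (F.P K) 0) (fun κ z => unitsField (toUField W) ⟨z, κ⟩) (fun κ z => Complex.I • X ⟨z, κ⟩) x) j k‖ ^ 2) :=
    Finset.sum_nonneg fun _ _ => Finset.sum_nonneg fun _ _ => Finset.sum_nonneg fun _ _ => sq_nonneg _
  have hC0 : 0 ≤ (∑ x : Site (F.P K) 0, ∑ μ : Fin (F.P K).d, ∑ ν : Fin (F.P K).d, (if μ < ν then ∑ j : Fin 2, ∑ k : Fin 2, ‖(curl (torusT (F.P K) 0) (fun κ z => unitsField (toUField W) ⟨z, κ⟩) (fun κ z => pertVar W (emb15 W (expHermField X)) ⟨z, κ⟩) μ ν x) j k‖ ^ 2 else 0)) := by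
    refine Finset.sum_nonneg fun x _ => Finset.sum_nonneg fun μ _ => Finset.sum_nonneg fun ν _ => ?_
    split_ifs
    · exact Finset.sum_nonneg fun _ _ => Finset.sum_nonneg fun _ _ => sq_nonneg _
    · exact le_rfl
  have hD00 : 0 ≤ (∑ x : Site (F.P K) 0, ∑ j : Fin 2, ∑ k : Fin 2, ‖(divB (torusT (F.P K) 0) (fun κ z => unitsField (toUField W) ⟨z, κ⟩) (fun κ z => pertVar W (emb15 W (expHermField X)) ⟨z, κ⟩) x) j k‖ ^ 2) :=
    Finset.sum_nonneg fun _ _ => Finset.sum_nonneg fun _ _ => Finset.sum_nonneg fun _ _ => sq_nonneg _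
  have hcoef0 : 0 ≤ 384 * (e * (((F.L : ℝ) ^ (K - n)) ^ 2)⁻¹) ^ 2 + 60 * s ^ 2 + 12 * (e * (((F.L : ℝ) ^ (K - n)) ^ 2)⁻¹) := by positivity
  have hcoef1 : 0 ≤ 192 * (e * (((F.L : ℝ) ^ (K - n)) ^ 2)⁻¹) ^ 2 + 12 * (e * (((F.L : ℝ) ^ (K - n)) ^ 2)⁻¹) := by positivity
  have hL4 : 0 ≤ 28800 * (F.L : ℝ) ^ 4 := by positivity
  have hL4' : 0 ≤ 600000 * (F.L : ℝ) ^ 4 * (((F.L : ℝ) ^ (K - n)) ^ 2)⁻¹ := by positivity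
  have hL9 : 0 ≤ 4 * 10 ^ 9 * (F.L : ℝ) ^ 9 * e * (((F.L : ℝ) ^ (K - n)) ^ 2)⁻¹ := by positivity
  have hθ4 : 0 ≤ 2000000 * (F.L : ℝ) ^ 4 * (3744000 * (F.L : ℝ) ^ 7 * (((F.L : ℝ) ^ (K - n)) * s)) ^ 2 * (((F.L : ℝ) ^ (K - n)) ^ 2)⁻¹ := by positivity
  -- ★ N6c-2 at the member
  have hmain := sum_norm_levelRatio_sub_trueLinIter_le_of_rows W (emb15 W (expHermField X)) hk Q hQ0 hQs G1 hG10 hG1s (fun b => Complex.I • X b)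
    (fun j : ℕ => (((((F.P K).d + 2) * (F.P K).L : ℕ) : ℝ)) ^ 2 / 2 * (2 * e) * ((((F.P K).L : ℝ)) ^ (2 * j) / (((F.P K).L : ℝ)) ^ (2 * (K - n))))
    (fun j => by positivity)
    (fun j hj c i => hαg j (by omega) c i)
    (fun j hj => (hale j (by omega)).trans h24)
    (fun j hj => (hale j (by omega)).trans_lt hN)
    (fun j : ℕ => 16 * (F.L : ℝ) ^ j * s)
    (fun j hj => by positivity)
    (fun j hj b => hsup j (by omega) b)
    (fun j hj => by rw [eμ]; exact hμ72 j (by omega))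
    (fun j hj => by
      rw [eμ]
      have h1 := hμN j (by omega)
      have h2 := (hale j (by omega)).trans h24
      linarith)
    hL2 hρ₁ hρ₂
    (fun j hj => l1_level_exp_le_T3 F n K he heL' j (by omega))
    (fun i hi => exp_two_mul_le_of (level_exp_le F n K he heL' i (by omega)))
    (AM := 7 * (∑ b : PBond (F.P K) 0, ‖pertVar W (emb15 W (expHermField X)) b‖ ^ 2))
    (BM := (28800 * (F.L : ℝ) ^ 4 * ((∑ x : Site (F.P K) 0, ∑ μ : Fin (F.P K).d, ∑ ν : Fin (F.P K).d, (if μ < ν then ∑ j : Fin 2, ∑ k : Fin 2, ‖(curl (torusT (F.P K) 0) (fun κ z => unitsField (toUField W) ⟨z, κ⟩) (fun κ z => pertVar W (emb15 W (expHermField X)) ⟨z, κ⟩) μ ν x) j k‖ ^ 2 else 0)) + (∑ x : Site (F.P K) 0, ∑ j : Fin 2, ∑ k : Fin 2, ‖(divB (torusT (F.P K) 0) (fun κ z => unitsField (toUField W) ⟨z, κ⟩) (fun κ z => pertVar W (emb15 W (expHermField X)) ⟨z, κ⟩) x) j k‖ ^ 2)) + 600000 * (F.L : ℝ) ^ 4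 * (((F.L : ℝ) ^ (K - n)) ^ 2)⁻¹ * (∑ b : PBond (F.P K) 0, ‖pertVar W (emb15 W (expHermField X)) b‖ ^ 2)))
    (BD := (72 * (200 * (F.L : ℝ) ^ 4 * ((∑ x : Site (F.P K) 0, ∑ μ : Fin (F.P K).d, ∑ ν : Fin (F.P K).d, (if μ < ν then ∑ j : Fin 2, ∑ k : Fin 2, ‖(curl (torusT (F.P K) 0) (fun κ z => unitsField (toUField W) ⟨z, κ⟩) (fun κ z => pertVar W (emb15 W (expHermField X)) ⟨z, κ⟩) μ ν x) j k‖ ^ 2 else 0)) + (∑ x : Site (F.P K) 0, ∑ j : Fin 2, ∑ k : Fin 2, ‖(divB (torusT (F.P K) 0) (fun κ z => unitsField (toUField W) ⟨z, κ⟩) (fun κ z => pertVar W (emb15 W (expHermField X)) ⟨z, κ⟩) x) j k‖ ^ 2))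
          + 4 * 10 ^ 9 * (F.L : ℝ) ^ 9 * e * (((F.L : ℝ) ^ (K - n)) ^ 2)⁻¹ * (∑ b : PBond (F.P K) 0, ‖pertVar W (emb15 W (expHermField X)) b‖ ^ 2)) + 2000000 * (F.L : ℝ) ^ 4 * (3744000 * (F.L : ℝ) ^ 7 * (((F.L : ℝ) ^ (K - n)) * s)) ^ 2 * (((F.L : ℝ) ^ (K - n)) ^ 2)⁻¹ * (∑ b : PBond (F.P K) 0, ‖pertVar W (emb15 W (expHermField X)) b‖ ^ 2)))
    (M₀' := (∑ b : PBond (F.P K) 0, ‖pertVar W (emb15 W (expHermField X)) b‖ ^ 2))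
    (GAP₀ := (8 * (∑ p : Plaq (F.P K) 0, ‖((Complex.I • X ⟨p.src, p.μ⟩) + ((W ⟨p.src, p.μ⟩ : Matrix (Fin 2) (Fin 2) ℂ) * (Complex.I • X ⟨p.src.shift p.μ, p.ν⟩) * star (W ⟨p.src, p.μ⟩ : Matrix (Fin 2) (Fin 2) ℂ)) - (((W ⟨p.src, p.μ⟩ * W ⟨p.src.shift p.μ, p.ν⟩ * (W ⟨p.src.shift p.ν, p.μ⟩)⁻¹ : Matrix.specialUnitaryGroup (Fin 2) ℂ) : Matrix (Fin 2) (Fin 2) ℂ) * (Complex.I • X ⟨p.src.shift p.ν, p.μ⟩) * star ((W ⟨p.src, p.μ⟩ * W ⟨p.src.shift p.μ, p.ν⟩ * (W ⟨p.src.shift p.ν, p.μ⟩)⁻¹ : Matrix.specialUnitaryGroup (Fin 2) ℂ) : Matrix (Fin 2) (Fin 2) ℂ)) - (((GaugeField.plaqHol W p : Matrix.specialUnitaryGroup (Fin 2) ℂ) : Matrix (Fin 2) (Fin 2) ℂ) * (Complex.I • X ⟨p.src, p.ν⟩) * star ((GaugeField.plaqHol W p : Matrix.specialUnitaryGroup (Fin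 2) ℂ) : Matrix (Fin 2) (Fin 2) ℂ)))‖ ^ 2)
          + 2 * (∑ x : Site (F.P K) 0, ∑ j : Fin 2, ∑ k : Fin 2, ‖(divB (torusT (F.P K) 0) (fun κ z => unitsField (toUField W) ⟨z, κ⟩) (fun κ z => Complex.I • X ⟨z, κ⟩) x) j k‖ ^ 2) + (384 * (e * (((F.L : ℝ) ^ (K - n)) ^ 2)⁻¹) ^ 2 + 60 * s ^ 2 + 12 * (e * (((F.L : ℝ) ^ (K - n)) ^ 2)⁻¹)) * (∑ b : PBond (F.P K) 0, ‖X b‖ ^ 2)))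
    (M₁ := (∑ b : PBond (F.P K) 0, ‖X b‖ ^ 2) / 2)
    (GAP₁ := ((4 * (∑ p : Plaq (F.P K) 0, ‖((Complex.I • X ⟨p.src, p.μ⟩) + ((W ⟨p.src, p.μ⟩ : Matrix (Fin 2) (Fin 2) ℂ) * (Complex.I • X ⟨p.src.shift p.μ, p.ν⟩) * star (W ⟨p.src, p.μ⟩ : Matrix (Fin 2) (Fin 2) ℂ)) - (((W ⟨p.src, p.μ⟩ * W ⟨p.src.shift p.μ, p.ν⟩ * (W ⟨p.src.shift p.ν, p.μ⟩)⁻¹ : Matrix.specialUnitaryGroup (Fin 2) ℂ) : Matrix (Fin 2) (Fin 2) ℂ) * (Complex.I • X ⟨p.src.shift p.ν, p.μ⟩) * star ((W ⟨p.src, p.μ⟩ * W ⟨p.src.shift p.μ, p.ν⟩ * (W ⟨p.src.shift p.ν, p.μ⟩)⁻¹ : Matrix.specialUnitaryGroup (Fin 2) ℂ) : Matrix (Fin 2) (Fin 2) ℂ)) - (((GaugeField.plaqHol W p : Matrix.specialUnitaryGroup (Fin 2) ℂ) : Matrix (Fin 2) (Fin 2) ℂ) * (Complex.I • X ⟨p.src,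 p.ν⟩) * star ((GaugeField.plaqHol W p : Matrix.specialUnitaryGroup (Fin 2) ℂ) : Matrix (Fin 2) (Fin 2) ℂ)))‖ ^ 2)
          + (∑ x : Site (F.P K) 0, ∑ j : Fin 2, ∑ k : Fin 2, ‖(divB (torusT (F.P K) 0) (fun κ z => unitsField (toUField W) ⟨z, κ⟩) (fun κ z => Complex.I • X ⟨z, κ⟩) x) j k‖ ^ 2) + (192 * (e * (((F.L : ℝ) ^ (K - n)) ^ 2)⁻¹) ^ 2 + 12 * (e * (((F.L : ℝ) ^ (K - n)) ^ 2)⁻¹)) * (∑ b : PBond (F.P K) 0, ‖X b‖ ^ 2)) / 2))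
    (cG := 26136)
    (mul_nonneg (by norm_num) hM00)
    (add_nonneg (mul_nonneg hL4 (add_nonneg hC0 hD00)) (mul_nonneg hL4' hM00))
    (add_nonneg (mul_nonneg (by norm_num) (add_nonneg (mul_nonneg (by positivity) (add_nonneg hC0 hD00)) (mul_nonneg hL9 hM00))) (mul_nonneg hθ4 hM00)) hM00
    (add_nonneg (add_nonneg (mul_nonneg (by norm_num) hKX0) (mul_nonneg (by norm_num) hDX0)) (mul_nonneg hcoef0 hMX0))
    (div_nonneg hMX0 (by norm_num))
    (div_nonneg (add_nonneg (add_nonneg (mul_nonneg (by norm_num) hKX0) hDX0) (mul_nonneg hcoef1 hMX0)) (by norm_num))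
    (by norm_num)
    (fun i hi => hn3 i (by omega))
    (fun i hi => hdev i (by omega))
    (fun j hj => (sum_centres_sum_normSq_bond_le (P := F.P K) (k := l) (j := j) hd hk (by omega) (pertVar W (emb15 W (expHermField X)))).trans
      (add_le_add le_rfl (mul_le_mul_of_nonneg_left hN4b (by positivity))))
    (fun j hj => by
      have hloc := sum_centres_sum_normSq_bond_le (P := F.P K) (k := l) (j := j) hd hk (by omega) X
      have h1 : ∑ z ∈ (univ.filter (fun w : Site (F.P K) (j + 1) => ∀ κ, (w κ).val % (F.P K).L ^ (l - (j + 1)) = ((F.P K).L ^ (l - (j + 1)) - 1) / 2)), ∑ b ∈ (univ.filter (fun b : PBond (F.P K) 0 => ∀ κ, ((b.src κ - (((z κ).val * (F.P K).L ^ (j + 1 - 0) + ((F.P K).L ^ (j + 1 - 0) - 1) / 2 : ℕ) : ZMod ((F.P K).sitesPerDir 0))).valMinAbs).natAbs ≤ (F.P K).L ^ (j + 1 - 0) - 2)), ‖pertVar W (emb15 W (expHermField X)) b - (fun b => Complex.I • X b) b‖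
          ≤ ∑ z ∈ (univ.filter (fun w : Site (F.P K) (j + 1) => ∀ κ, (w κ).val % (F.P K).L ^ (l - (j + 1)) = ((F.P K).L ^ (l - (j + 1)) - 1) / 2)), ∑ b ∈ (univ.filter (fun b : PBond (F.P K) 0 => ∀ κ, ((b.src κ - (((z κ).val * (F.P K).L ^ (j + 1 - 0) + ((F.P K).L ^ (j + 1 - 0) - 1) / 2 : ℕ) : ZMod ((F.P K).sitesPerDir 0))).valMinAbs).natAbs ≤ (F.P K).L ^ (j + 1 - 0) - 2)), (1 / 2) * ‖X b‖ ^ 2 :=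
        Finset.sum_le_sum fun z _ => Finset.sum_le_sum fun b _ => (hpt b).trans_eq (by ring)
      rw [show (∑ z ∈ (univ.filter (fun w : Site (F.P K) (j + 1) => ∀ κ, (w κ).val % (F.P K).L ^ (l - (j + 1)) = ((F.P K).L ^ (l - (j + 1)) - 1) / 2)), ∑ b ∈ (univ.filter (fun b : PBond (F.P K) 0 => ∀ κ, ((b.src κ - (((z κ).val * (F.P K).L ^ (j + 1 - 0) + ((F.P K).L ^ (j + 1 - 0) - 1) / 2 : ℕ) : ZMod ((F.P K).sitesPerDir 0))).valMinAbs).natAbs ≤ (F.P K).L ^ (j + 1 - 0) - 2)), (1 / 2) * ‖X b‖ ^ 2)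
          = (1 / 2) * ∑ z ∈ (univ.filter (fun w : Site (F.P K) (j + 1) => ∀ κ, (w κ).val % (F.P K).L ^ (l - (j + 1)) = ((F.P K).L ^ (l - (j + 1)) - 1) / 2)), ∑ b ∈ (univ.filter (fun b : PBond (F.P K) 0 => ∀ κ, ((b.src κ - (((z κ).val * (F.P K).L ^ (j + 1 - 0) + ((F.P K).L ^ (j + 1 - 0) - 1) / 2 : ℕ) : ZMod ((F.P K).sitesPerDir 0))).valMinAbs).natAbs ≤ (F.P K).L ^ (j + 1 - 0) - 2)), ‖X b‖ ^ 2 by simp_rw [Finset.mul_sum]] at h1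
      have h26 : (0 : ℝ) ≤ 26136 * ((F.P K).L : ℝ) ^ (2 * (j + 1)) := by positivity
      exact loc1_shape h1 hloc hgapX h26)
  -- the member's numerals
  beta_reduce at hmain
  rw [ecE] at hmain
  rw [eCL, eCd, etd] at hmain
  rw [eL] at hmain
  have hx0 : 0 ≤ ((F.L : ℝ) ^ l)⁻¹ := by positivity
  exact final_shape hmain hD0 hx0

/-- ★★★ **THE «(n3)₂-sym» ROW `hN2s` OF ✓`Prop7SymFrameRem2RowOfN32Sym.hRs_of_hN2s`, VERBATIM, PROVED**: for every odd `L > 1` and `B₁′ > 0` there are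
`e₂ = T⁻¹` (`T = 10¹⁴L⁹ + 4·10¹¹L⁹·(2B₁′)`) and the POLYNOMIAL constants `A₂(L), B₂(L), B₂′(L)` of ✓`Prop7N32SymExchangeReals` such that for every member of the
family with `F.L = L`, every `n < K`, every `W ∈ regFibrePr` and every chart field `X` in print's windows (`In19` at radius `2B₁′e`), and every level `l < K − n`, the
single-bar second-order linearisation remainder of the plain symmetric tower in `ℓ¹` is `≤ A₂·M·(Lˡ)⁻¹ + (B₂·(K_W(iX) + DIV_W(iX)) + B₂′·(ℓ²)⁻¹·M)·Lˡ`
(§1 ∘ ✓N6s `fderiv_emlIterU_mul_star_eq_trueLinIter_of_regPr` ∘ ✓`exchange_shape`; the Euler–Lagrange clause, `AvgCondPrint` and `IsLandauPrint` are not used).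
[cite: Balaban1985Averaging, Prop. 3 (122)-(126) p.36, Prop. 4 (134)-(135) p.38; Balaban1984PropagatorsI, (1.18)-(1.20) pp.19-20; Balaban1985Variational, (2) p.278, (15) p.280, (19)-(20) p.281, (44)-(48) pp.285-286, Prop. 7 p.299] -/
theorem hN2s_holds :
    ∀ (L : ℕ), 1 < L → ∀ (B₁' : ℝ), 0 < B₁' → ∃ e₂ A₂ B₂ B₂' : ℝ, 0 < e₂ ∧ 0 ≤ A₂ ∧ 0 ≤ B₂ ∧ 0 ≤ B₂' ∧
      ∀ (F : T3Family), F.L = L → ∀ (n K : ℕ) (hnK : n < K) (e : ℝ) (V : GaugeField (F.P n) 0 (Matrix.specialUnitaryGroup (Fin 2) ℂ))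
        (W : GaugeField (F.P K) 0 (Matrix.specialUnitaryGroup (Fin 2) ℂ)) (X : PBond (F.P K) 0 → Matrix (Fin 2) (Fin 2) ℂ),
        0 < e → e ≤ e₂ → W ∈ regFibrePr F n K hnK.le e V →
        (∀ γ : ℝ → GaugeField (F.P K) 0 (Matrix.specialUnitaryGroup (Fin 2) ℂ), γ 0 = W → (∀ t, γ t ∈ fibre F ℰp n K hnK.le V) →
          (∀ b, DifferentiableAt ℝ (fun t => ((γ t b : Matrix.specialUnitaryGroup (Fin 2) ℂ) : Matrix (Fin 2) (Fin 2) ℂ)) 0) →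
            deriv (fun t => wilsonAction4 (γ t)) 0 = 0) →
        In19 F n K (2 * B₁' * e) W (expHermField X) X → AvgCondPrint F n K hnK.le V W X → IsLandauPrint F n K W X →
          ∀ l : ℕ, l < K - n →
            ∑ b : PBond (F.P K) l,
              ‖pertVar (Averaging.iter (fun i => blockAvg (P := (F.P K)) (j := i) (expMeanLogSU (n := Fin 2))) l W)
                (Averaging.iter (fun i => blockAvg (P := (F.P K)) (j := i) (expMeanLogSU (n := Fin 2))) l (emb15 W (expHermField X))) b
              - fderiv ℂ (fun t : PBond (F.P K) 0 → Matrix (Fin 2) (Fin 2) ℂ =>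
                  ((emlIterU l (fun b' => expUnit (t b') * bgUnits F K W b') b : (Matrix (Fin 2) (Fin 2) ℂ)ˣ) : Matrix (Fin 2) (Fin 2) ℂ)) 0 (fun b' => Complex.I • X b')
                * star ((Averaging.iter (fun i => blockAvg (P := (F.P K)) (j := i) (expMeanLogSU (n := Fin 2))) l W b : Matrix.specialUnitaryGroup (Fin 2) ℂ) : Matrix (Fin 2) (Fin 2) ℂ)‖
              ≤ A₂ * (∑ b : PBond (F.P K) 0, ‖X b‖ ^ 2) * ((F.L : ℝ) ^ l)⁻¹
                + (B₂ * ((∑ p : Plaq (F.P K) 0, ‖((Complex.I • X ⟨p.src, p.μ⟩) + ((W ⟨p.src, p.μ⟩ : Matrix (Fin 2) (Fin 2) ℂ) * (Complex.I • X ⟨p.src.shift p.μ, p.ν⟩) * star (W ⟨p.src, p.μ⟩ : Matrix (Fin 2) (Fin 2) ℂ))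
            - (((W ⟨p.src, p.μ⟩ * W ⟨p.src.shift p.μ, p.ν⟩ * (W ⟨p.src.shift p.ν, p.μ⟩)⁻¹ : Matrix.specialUnitaryGroup (Fin 2) ℂ) : Matrix (Fin 2) (Fin 2) ℂ) * (Complex.I • X ⟨p.src.shift p.ν, p.μ⟩) * star ((W ⟨p.src, p.μ⟩ * W ⟨p.src.shift p.μ, p.ν⟩ * (W ⟨p.src.shift p.ν, p.μ⟩)⁻¹ : Matrix.specialUnitaryGroup (Fin 2) ℂ) : Matrix (Fin 2) (Fin 2) ℂ))
            - (((GaugeField.plaqHol W p : Matrix.specialUnitaryGroup (Fin 2) ℂ) : Matrix (Fin 2) (Fin 2) ℂ) * (Complex.I • X ⟨p.src, p.ν⟩) * star ((GaugeField.plaqHol W p : Matrix.specialUnitaryGroup (Fin 2) ℂ) : Matrix (Fin 2) (Fin 2) ℂ)))‖ ^ 2) + (∑ x : Site (F.P K) 0, ∑ j : Fin 2, ∑ k : Fin 2,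
              ‖(divB (torusT (F.P K) 0) (fun κ z => unitsField (toUField W) ⟨z, κ⟩) (fun κ z => Complex.I • X ⟨z, κ⟩) x) j k‖ ^ 2))
                  + B₂' * (((F.L : ℝ) ^ (K - n)) ^ 2)⁻¹ * (∑ b : PBond (F.P K) 0, ‖X b‖ ^ 2)) * (F.L : ℝ) ^ l := by
  intro L hL B₁' hB₁'
  have hL0 : (0 : ℝ) < (L : ℝ) := by exact_mod_cast (show 0 < L by omega)
  obtain ⟨T, hT_def⟩ : ∃ T : ℝ, T = 100000000000000 * (L : ℝ) ^ 9 + 400000000000 * (L : ℝ) ^ 9 * (2 * B₁') := ⟨_, rfl⟩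
  have hTpos : 0 < T := by rw [hT_def]; positivity
  obtain ⟨hA₂0, hB₂0, hB₂'0⟩ := constants_nonneg hL0.le
  refine ⟨T⁻¹, (3 / 4 + 3 / 2 * 234000 * 7 * (L : ℝ) ^ 7 + 45 * (L : ℝ) ^ 7 + 45 * 234000 * 9 * (L : ℝ) ^ 14),
    (3 / 2 * 234000 * 28800 * 2 * 8 * (L : ℝ) ^ 9 + 45 * 26136 * 2 * (L : ℝ) ^ 3 + 45 * 234000 * (9 / 2) * 26136 * 8 * (L : ℝ) ^ 10 + 45 * 234000 * 16 * 2 * 115200 * (L : ℝ) ^ 10),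
    (3 / 2 * 234000 * 2 * (28800 * 444 + 600000) * (L : ℝ) ^ 9 + 45 * 26136 * 102 * (L : ℝ) ^ 3 + 45 * 234000 * (9 / 2) * 26136 * 456 * (L : ℝ) ^ 10 + 45 * 234000 * 16 * 2 * (8393600 * (L : ℝ) ^ 10 + 288000000000 * (L : ℝ) ^ 15)),
    inv_pos.mpr hTpos, hA₂0, hB₂0, hB₂'0, ?_⟩
  intro F hF n K hnK e V W X he heS hWreg _hEL h19 _h20 _h21 l hl
  have heT : T * e ≤ 1 := by
    calc T * e ≤ T * T⁻¹ := mul_le_mul_of_nonneg_left heS hTpos.le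
      _ = 1 := mul_inv_cancel₀ hTpos.ne'
  have t1 : (0 : ℝ) ≤ 100000000000000 * (L : ℝ) ^ 9 := by positivity
  have t2 : (0 : ℝ) ≤ 400000000000 * (L : ℝ) ^ 9 * (2 * B₁') := by positivity
  have w1 : 100000000000000 * (L : ℝ) ^ 9 * e ≤ 1 :=
    (mul_le_mul_of_nonneg_right (show 100000000000000 * (L : ℝ) ^ 9 ≤ T by rw [hT_def]; linarith only [t2]) he.le).trans heT
  have w3 : 400000000000 * (L : ℝ) ^ 9 * (2 * B₁') * e ≤ 1 :=
    (mul_le_mul_of_nonneg_right (show 400000000000 * (L : ℝ) ^ 9 * (2 * B₁') ≤ T by rw [hT_def]; linarith only [t1]) he.le).trans heT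
  subst hF
  obtain ⟨-, hreg⟩ := (mem_regFibrePr_iff F).mp hWreg
  have hL3 : (3 : ℝ) ≤ (F.L : ℝ) := three_le_L F
  have hL1 : (1 : ℝ) ≤ (F.L : ℝ) := by linarith
  have hℓ1 : (1 : ℝ) ≤ (F.L : ℝ) ^ (K - n) := one_le_pow₀ hL1
  have hℓ0 : (0 : ℝ) < (F.L : ℝ) ^ (K - n) := by positivity
  have hD : ∀ b : PBond (F.P K) 0, (X b).IsHermitian ∧ Matrix.trace (X b) = 0 := h19.1
  have hη : eta F n K = ((F.L : ℝ) ^ (K - n))⁻¹ := by rw [eta, inv_pow]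
  -- the sup letter `s := 2B₁′e·ℓ⁻¹`
  obtain ⟨s, hs_def⟩ : ∃ s : ℝ, s = 2 * B₁' * e * ((F.L : ℝ) ^ (K - n))⁻¹ := ⟨_, rfl⟩
  have hs0 : 0 ≤ s := by rw [hs_def]; positivity
  have hℓs : ((F.L : ℝ) ^ (K - n)) * s = 2 * B₁' * e := by
    rw [hs_def]; field_simp
  have hsL : 400000000000 * (F.L : ℝ) ^ 9 * (((F.L : ℝ) ^ (K - n)) * s) ≤ 1 := by
    rw [hℓs]; linarith only [w3]
  have h2e : 2 * B₁' * e ≤ 1 := by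
    have hL9 : (1 : ℝ) ≤ 400000000000 * (F.L : ℝ) ^ 9 := by
      have := one_le_pow₀ (n := 9) hL1
      linarith only [this]
    have h0 : 0 ≤ 2 * B₁' * e := by positivity
    calc 2 * B₁' * e = 1 * (2 * B₁' * e) := (one_mul _).symm
      _ ≤ 400000000000 * (F.L : ℝ) ^ 9 * (2 * B₁' * e) := mul_le_mul_of_nonneg_right hL9 h0
      _ ≤ 1 := by linarith only [w3]
  have hs4 : 4 * s ≤ 1 := by
    have h1 : s ≤ ((F.L : ℝ) ^ (K - n)) * s := le_mul_of_one_le_left hs0 hℓ1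
    rw [hℓs] at h1
    have hL9 : (4 : ℝ) ≤ 400000000000 * (F.L : ℝ) ^ 9 := by
      have := one_le_pow₀ (n := 9) hL1
      linarith only [this]
    have h0 : 0 ≤ 2 * B₁' * e := by positivity
    calc 4 * s ≤ 4 * (2 * B₁' * e) := by linarith only [h1]
      _ ≤ 400000000000 * (F.L : ℝ) ^ 9 * (2 * B₁' * e) := mul_le_mul_of_nonneg_right hL9 h0
      _ ≤ 1 := by linarith only [w3]
  have hsX : ∀ b : PBond (F.P K) 0, ‖X b‖ ≤ s := by
    intro b
    have hb := (h19.2.2.1 b).le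
    rw [hη] at hb
    rw [hs_def]
    exact hb
  -- the true-linearised iterate and §1
  obtain ⟨Q, hQ0, hQs⟩ := exists_trueLinIter_family (P := F.P K) (N := 2) W
  have hA := sum_norm_levelRatio_sub_trueLinIter_le_of_regPr F n K he w1 hs0 hs4 hsL hreg X hD hsX Q hQ0 hQs l hl
  -- the seam (✓N6s): the displayed summand IS `‖Y_l b − Q l (iX) b‖`
  have hseam := fderiv_emlIterU_mul_star_eq_trueLinIter_of_regPr F n K he w1 hs0 hs4 hsL W hreg X hD hsX Q hQ0 hQs l hl.le
  have hgoal : ∑ b : PBond (F.P K) l,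
        ‖pertVar (Averaging.iter (fun i => blockAvg (P := (F.P K)) (j := i) (expMeanLogSU (n := Fin 2))) l W)
          (Averaging.iter (fun i => blockAvg (P := (F.P K)) (j := i) (expMeanLogSU (n := Fin 2))) l (emb15 W (expHermField X))) b
        - fderiv ℂ (fun t : PBond (F.P K) 0 → Matrix (Fin 2) (Fin 2) ℂ =>
            ((emlIterU l (fun b' => expUnit (t b') * bgUnits F K W b') b : (Matrix (Fin 2) (Fin 2) ℂ)ˣ) : Matrix (Fin 2) (Fin 2) ℂ)) 0 (fun b' => Complex.I • X b')
          * star ((Averaging.iter (fun i => blockAvg (P := (F.P K)) (j := i) (expMeanLogSU (n := Fin 2))) l W b : Matrix.specialUnitaryGroup (Fin 2) ℂ) : Matrix (Fin 2) (Fin 2) ℂ)‖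
      = ∑ c : PBond (F.P K) l, ‖(pertVar (Averaging.iter (fun i => blockAvg (P := (F.P K)) (j := i) (expMeanLogSU (n := Fin 2))) l W) (Averaging.iter (fun i => blockAvg (P := (F.P K)) (j := i) (expMeanLogSU (n := Fin 2))) l (emb15 W (expHermField X)))) c - Q l (fun b => Complex.I • X b) c‖ :=
    Finset.sum_congr rfl fun b _ => by rw [hseam b]
  rw [hgoal]
  -- the currency exchange (★routeR-w4) and the absolute constants
  have hU := coe_emb15_expHermField_apply F W X hD
  have hXh : ∀ b : PBond (F.P K) 0, (X b).IsHermitian := fun b => (hD b).1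
  have hM₀ := sum_normSq_pertVar_le W (emb15 W (expHermField X)) X hXh hU
  have ha := plaq_le_of_regPr F n K hreg
  have hCU := curlHS_pertVar_le_plaqK W (emb15 W (expHermField X)) X hXh hU hsX ha
  have hDV := divHS_pertVar_le W (emb15 W (expHermField X)) X hXh hU hsX
  have hd' : ((F.P K).d : ℝ) = 3 := by rw [T3Family.P_d F K]; norm_num
  have hCD := cd_shape (by norm_num) hd' hCU hDV
  have he1 : e ≤ 1 := by
    have h9' : (1 : ℝ) ≤ (F.L : ℝ) ^ 9 := one_le_pow₀ hL1
    have : e ≤ (F.L : ℝ) ^ 9 * e := le_mul_of_one_le_left he.le h9'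
    linarith only [this, w1, he.le]
  have hMX0 : 0 ≤ (∑ b : PBond (F.P K) 0, ‖X b‖ ^ 2) := Finset.sum_nonneg fun _ _ => sq_nonneg _
  have hM00 : 0 ≤ (∑ b : PBond (F.P K) 0, ‖pertVar W (emb15 W (expHermField X)) b‖ ^ 2) := Finset.sum_nonneg fun _ _ => sq_nonneg _
  have hKX0 : 0 ≤ (∑ p : Plaq (F.P K) 0, ‖((Complex.I • X ⟨p.src, p.μ⟩)
          + ((W ⟨p.src, p.μ⟩ : Matrix (Fin 2) (Fin 2) ℂ) * (Complex.I • X ⟨p.src.shift p.μ, p.ν⟩) * star (W ⟨p.src, p.μ⟩ : Matrix (Fin 2) (Fin 2) ℂ))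
          - (((W ⟨p.src, p.μ⟩ * W ⟨p.src.shift p.μ, p.ν⟩ * (W ⟨p.src.shift p.ν, p.μ⟩)⁻¹ : Matrix.specialUnitaryGroup (Fin 2) ℂ) : Matrix (Fin 2) (Fin 2) ℂ)
              * (Complex.I • X ⟨p.src.shift p.ν, p.μ⟩)
              * star ((W ⟨p.src, p.μ⟩ * W ⟨p.src.shift p.μ, p.ν⟩ * (W ⟨p.src.shift p.ν, p.μ⟩)⁻¹ : Matrix.specialUnitaryGroup (Fin 2) ℂ) : Matrix (Fin 2) (Fin 2) ℂ))
          - (((GaugeField.plaqHol W p : Matrix.specialUnitaryGroup (Fin 2) ℂ) : Matrix (Fin 2) (Fin 2) ℂ) * (Complex.I • X ⟨p.src, p.ν⟩)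
              * star ((GaugeField.plaqHol W p : Matrix.specialUnitaryGroup (Fin 2) ℂ) : Matrix (Fin 2) (Fin 2) ℂ)))‖ ^ 2) := Finset.sum_nonneg fun _ _ => sq_nonneg _
  have hDX0 : 0 ≤ (∑ x : Site (F.P K) 0, ∑ j : Fin 2, ∑ k : Fin 2,
            ‖(divB (torusT (F.P K) 0) (fun κ z => unitsField (toUField W) ⟨z, κ⟩) (fun κ z => Complex.I • X ⟨z, κ⟩) x) j k‖ ^ 2) :=
    Finset.sum_nonneg fun _ _ => Finset.sum_nonneg fun _ _ => Finset.sum_nonneg fun _ _ => sq_nonneg _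
  have hC0 : 0 ≤ (∑ x : Site (F.P K) 0, ∑ μ : Fin (F.P K).d, ∑ ν : Fin (F.P K).d,
            (if μ < ν then ∑ j : Fin 2, ∑ k : Fin 2,
              ‖(curl (torusT (F.P K) 0) (fun κ z => unitsField (toUField W) ⟨z, κ⟩) (fun κ z => pertVar W (emb15 W (expHermField X)) ⟨z, κ⟩) μ ν x) j k‖ ^ 2 else 0)) := by
    refine Finset.sum_nonneg fun x _ => Finset.sum_nonneg fun μ _ => Finset.sum_nonneg fun ν _ => ?_
    split_ifs
    · exact Finset.sum_nonneg fun _ _ => Finset.sum_nonneg fun _ _ => sq_nonneg _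
    · exact le_rfl
  have hD00 : 0 ≤ (∑ x : Site (F.P K) 0, ∑ j : Fin 2, ∑ k : Fin 2,
            ‖(divB (torusT (F.P K) 0) (fun κ z => unitsField (toUField W) ⟨z, κ⟩) (fun κ z => pertVar W (emb15 W (expHermField X)) ⟨z, κ⟩) x) j k‖ ^ 2) :=
    Finset.sum_nonneg fun _ _ => Finset.sum_nonneg fun _ _ => Finset.sum_nonneg fun _ _ => sq_nonneg _
  have hx0 : 0 ≤ ((F.L : ℝ) ^ l)⁻¹ := by positivity
  have hy0 : 0 ≤ (F.L : ℝ) ^ l := by positivity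
  exact exchange_shape hx0 hy0 hL3 hℓ1 he.le he1 hs0 hsL hMX0 hM00 hM₀ hKX0 hDX0 (add_nonneg hC0 hD00) hCD hA


-- KERNEL WITNESS (no new content): px16's REM2ˢ packaging consumes the theorem by name.
example := hRs_of_hN2s hN2s_holds

end Summit.QuantumFields.YangMills.Theorems.Prop7N32SymRow

end
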